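import Summits.QuantumFields.YangMills.Theorems.LuscherReductionTwistedTraceScalingBTRecord
import HarnessLib

/-!
# (B-T) FOR AN ARBITRARY FIBRE PROFILE AND AN ARBITRARY SCHEDULE: the conditional assembly, generic
# (lane A of S-BASE, crux `TwistedTraceScaling` stmt-QuantumFields-20203, C4-CORE, the (B-T) pen; design note `pub/ym-fleet/ym-luscher-20007-p1/COARSE-DESIGN.md` §26)

WHY.  The profile of record `btOmega` (flat in the stiff directions, support radius `β^{-1/2}`) is good enough for (B-T) but NOT for (B-ST)/(B-OD): those need `Ω` to be an
`o(β^{-1/6})`-quasimode of the fibre kernel, i.e. (a truncation of) the frozen stiff Gaussian, whose mass sits at `‖v‖ ≍ β^{-1/2}·√(trace)` — outside the ball of radius `β^{-1/2}`.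
The (B-T) estimate is UNIFORM in the profile (it only uses `0 ≤ Ω ≤ 1`, measurability, colour blindness and the support radius), so we re-run its assembly with the profile
`Ω`, the fibre radius `r`, the near/far threshold `α` and the core jump radius `R₁` as VARIABLES:
* ★★★ `profile_hT_of_eventually` — for any profile family `Ω` (measurable, `0 ≤ Ω ≤ 1`, colour blind, supported in `{|v_{e,c}| ≤ r β, ‖v̂‖ ≤ r β}`, `γ > 0`), any schedule
  `0 < r ≤ 1/40`, `0 ≤ α`, any `R₁`, and any rate `κ' ≥ btKappa(schedule) + β^{-1}` eventually: the two eventual schedule facts (13 smallness + 6 budget conjuncts, verbatim those of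
  `…BTSchedule.recordBT_hT_of_eventually` with `btRad, btAlpha, btR1 ↦ r, α, R₁`) imply the `hT` field of `RecordAnalyticInput` for `Ω`, `σ = C_Ω/Z/γ`
  (`C_Ω β = btC L β (Ω β) (btEps β) (R₁ β)`), rate `κ'`;
* `btC_profile_pos` — `0 < C_Ω β` for `β ≥ 0` whenever `∫Ω_β dπ > 0` and `2ε/3 < R₁`.
The schedule of §26 (`r = β^{-1/2}ℓ ∧ 1/40`, `α = β^{-1/2}ℓ²`, `R₁ = 5α`) is instantiated in `…BTProfileRates` / `…BTProfileBudget` / `…BTProfileRecord`.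
HONEST FRAMING: a stub of a child of the CONDITIONAL reduction route R2b1; C4-CORE OPEN ((B-ST), (B-OD)); not infinite volume, not a gap, not Clay.
-/

set_option autoImplicit false

noncomputable section

open MeasureTheory Filter Topology Real
open scoped BigOperators Matrix Quaternion
open Literature.MathematicalPhysics.QuantumFieldTheory
open Literature.MathematicalPhysics.QuantumLattice

namespace Summit.QuantumFields.YangMills.Theorems.FemtoTransferGap.TwoLattice.ConstTube

open Summit.QuantumFields.YangMills.Theorems.FemtoTransferGap
open Summit.QuantumFields.YangMills.Theorems.FemtoTransferGap.TwoLattice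
open Summit.QuantumFields.YangMills.Theorems.FemtoTransferGap.TwoLattice.Avg
open Summit.QuantumFields.YangMills.Theorems.FemtoTransferGap.TwoLattice.Stiff (LinkSpace)
open Summit.QuantumFields.YangMills.Theorems.FemtoTransferGap.TwoLattice.Cov

variable {L : ℕ} [NeZero L]

/-! ## §1 ★★★ The conditional assembly for a generic profile and schedule -/

/-- ★★★ **(B-T) FOR A GENERIC PROFILE AND SCHEDULE, FROM THE TWO EVENTUAL SCHEDULE FACTS.** [cite: Luscher1983, §3] -/
theorem profile_hT_of_eventually {s : ℝ} (hs : 0 < s) {Ω : ℝ → LinkSpace L → ℝ} (hΩm : ∀ β, Measurable (Ω β)) (hΩ1 : ∀ β x, |Ω β x| ≤ 1) (hΩ0 : ∀ β x, 0 ≤ Ω β x)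
    (hΩinv : ∀ β (g : SU2) (x : LinkSpace L), Ω β (adL L g x) = Ω β x) {r α R₁ κ' : ℝ → ℝ}
    (hΩt : ∀ β (v : Edge 3 L → Fin 3 → ℝ), Ω β (linkEmbed L v) ≠ 0 → (∀ (e : Edge 3 L) (c : Fin 3), |v e c| ≤ r β) ∧ ‖linkEmbed L v‖ ≤ r β)
    (hγ : ∀ β, 0 < recordGamma L Ω β) (hr : ∀ β, 0 < r β ∧ r β ≤ 1 / 40) (hα : ∀ β, 0 ≤ α β)
    (hκ' : ∀ᶠ β : ℝ in atTop, btKappa L β (recordDelta1 L s β) (α β) (9 * L * R₁ β + btEps β) (r β) (btEps β * Fintype.card (Site 3 L))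
      ((L : ℝ) ^ 3 * (12 * recordDelta1 L s β ^ 4)) + powScale 1 β ≤ κ' β)
    (hsmall : ∀ᶠ β : ℝ in atTop, 0 ≤ β ∧ recordDelta1 L s β ≤ 1 / 2 ∧ α β ≤ 1 ∧ r β ≤ 9 * L * R₁ β + btEps β ∧ 9 * L * R₁ β + btEps β ≤ 1 / 30 ∧
      (L : ℝ) ^ 3 * (12 * recordDelta1 L s β ^ 4) < 2 ∧
      coreEps1 L β (recordDelta1 L s β) (9 * L * R₁ β + btEps β) (r β) +
          coreEps2 L β (recordDelta1 L s β) (9 * L * R₁ β + btEps β) (r β) ((L : ℝ) ^ 3 * (12 * recordDelta1 L s β ^ 4)) ≤ 1 ∧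
      18 * L * (Real.sqrt 2 * r β + recordDelta1 L s β) ≤ 1 / 2 ∧
      0 ≤ R₁ β / 2 - 2 * (Real.sqrt 2 * r β + recordDelta1 L s β) * btEps β - (2 * Real.sqrt 2 * r β + α β) ∧
      0 ≤ 1 / (3 * L) - 4 * (Real.sqrt 2 * r β + recordDelta1 L s β) - (2 * Real.sqrt 2 * r β + α β) ∧
      3 * L * (13 * recordDelta1 L s β) < 1 ∧
      0 ≤ 13 * recordDelta1 L s β - 4 * (Real.sqrt 2 * r β + recordDelta1 L s β) - (2 * Real.sqrt 2 * r β + 2 * recordDelta1 L s β) ∧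
      2 * btEps β * Fintype.card (Site 3 L) * recordDelta1 L s β + 2 * r β ^ 2 +
          2 * Real.sqrt 2 * Fintype.card (Site 3 L) * (9 * L * (13 * recordDelta1 L s β) + btEps β) * r β ≤
        Fintype.card (Site 3 L) * (1 - 3 * L * (13 * recordDelta1 L s β)) * α β)
    (hbudget : ∀ᶠ β : ℝ in atTop, 1 ≤ (L : ℝ) ^ 3 * β ∧ 2 / rStar ^ 3 ≤ (L : ℝ) ^ 3 * β ∧ 2 * (btEps β / 3) < R₁ β ∧
      Real.exp (β * ((Fintype.card (Edge 3 L) : ℝ) * (2 * (btEps β / 3) + 2 * Real.sqrt 2 * r β) ^ 2) +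
            β * ((10 * Real.sqrt (Fintype.card (Plaquette 3 L × Fin 3)) * r β) ^ 2 + stepActionErr (L := L) (r β) 0)) *
          Real.exp (-(β * btMnt L (recordDelta1 L s β) (α β) (r β) (R₁ β) (btEps β))) ≤
        powScale 1 β / 3 * (gaugeMeasure L).real (gaugeCore L (btEps β / 3)) * (Real.exp (-3) * ((L : ℝ) ^ 3 * β) ^ (-(9 : ℝ) / 2) / 2000) ∧
      Real.exp (β * ((Fintype.card (Edge 3 L) : ℝ) * (2 * (btEps β / 3) + 2 * Real.sqrt 2 * r β) ^ 2) +
            β * ((10 * Real.sqrt (Fintype.card (Plaquette 3 L × Fin 3)) * r β) ^ 2 + stepActionErr (L := L) (r β) 0)) *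
          Real.exp (-(β * btMfar L (recordDelta1 L s β) (α β) (r β) (btEps β) (13 * recordDelta1 L s β))) ≤
        powScale 1 β / 3 * (gaugeMeasure L).real (gaugeCore L (btEps β / 3)) * (Real.exp (-3) * ((L : ℝ) ^ 3 * β) ^ (-(9 : ℝ) / 2) / 2000) ∧
      Real.exp (-((L : ℝ) ^ 3 * β * α β ^ 2)) ≤ powScale 1 β / 3 * (Real.exp (-3) * ((L : ℝ) ^ 3 * β) ^ (-(9 : ℝ) / 2) / 2000)) :
    ∀ᶠ β : ℝ in atTop, ∀ φ : GaugeConfig 3 1 SU2 → ℝ, Measurable φ → (∃ C : ℝ, ∀ u, |φ u| ≤ C) →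
      (∀ (g : Site 3 1 → SU2) (u : GaugeConfig 3 1 SU2), φ (gaugeTransform g u) = φ u) → (∀ u, φ u ≠ 0 → orbitDist u < recordDelta1 L s β) →
      |tubeForm β (boFun L φ (Ω β)) -
          (btC L β (Ω β) (btEps β) (R₁ β) / fpZ (btEps β) / recordGamma L Ω β) * recordGamma L Ω β * qform su2Rep ((L : ℝ) ^ 3 * β) φ φ| ≤
        κ' β * ((btC L β (Ω β) (btEps β) (R₁ β) / fpZ (btEps β) / recordGamma L Ω β) * recordGamma L Ω β) *
          (qform su2Rep ((L : ℝ) ^ 3 * β) φ φ + levelValue su2Rep 1 ((L : ℝ) ^ 3 * β) 0 * l2 φ φ) := by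
  have hW : ∀ β, Measurable (fpWeight L (btEps β)) := fun β => measurable_fpWeight L _
  have hCW : ∀ β g, |fpWeight L (btEps β) g| ≤ 1 := fun β g => abs_fpWeight_le L _ g
  have hZ0 : ∀ β, 0 < fpZ (btEps β) := fun β => fpZ_pos (btEps_pos_le β).1
  have hZ : ∀ β (g : Site 3 L → SU2), ∫ c, fpWeight L (btEps β) (fun x => c * g x) ∂haarProbability SU2 = fpZ (btEps β) := fun β g => fpWeight_orbit L _ g
  set Cf : ℝ → ℝ := fun β => btC L β (Ω β) (btEps β) (R₁ β) with hCfdef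
  have hC : ∀ β, 0 ≤ Cf β := fun β => by
    rw [hCfdef]; dsimp only; unfold btC
    exact div_nonneg (fpBOKernel_nonneg β (hΩm β) (hΩ1 β) (hΩ0 β) (measurable_coreWeight _ _) (abs_coreWeight_le _ _)
      (fun g => (coreWeight_mem_Icc _ _ g).1) 1 1) (transferKernel_pos _ _ _ _).le
  -- the schedule rates
  set κ : ℝ → ℝ := fun β => btKappa L β (recordDelta1 L s β) (α β) (9 * L * R₁ β + btEps β) (r β) (btEps β * Fintype.card (Site 3 L))
    ((L : ℝ) ^ 3 * (12 * recordDelta1 L s β ^ 4)) with hκdef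
  set τ : ℝ → ℝ := fun β => btTau L β (Ω β) (recordDelta1 L s β) (α β) (r β) (R₁ β) (btEps β) (13 * recordDelta1 L s β) (Cf β) with hτdef
  have hκ0 : ∀ β, 0 ≤ κ β := fun β => by rw [hκdef]; dsimp only; unfold btKappa; positivity
  have hκ₂ : ∀ β, 0 ≤ powScale 1 β := fun β => (powScale_pos _ _).le
  have hτ0 : ∀ β, 0 ≤ τ β := fun β => by rw [hτdef]; dsimp only; unfold btTau; have := hC β; positivity
  -- the two eventual inputs of the door
  have hτZ : ∀ᶠ β : ℝ in atTop, τ β / fpZ (btEps β) ≤ powScale 1 β * (Cf β / fpZ (btEps β)) * levelValue su2Rep 1 ((L : ℝ) ^ 3 * β) 0 := by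
    filter_upwards [hbudget, eventually_ge_atTop (0 : ℝ)] with β hb hβ
    obtain ⟨hB1, hB2, hρR, H1, H2, H3⟩ := hb
    have hρε : 2 * (btEps β / 3) < btEps β := by linarith [(btEps_pos_le β).1]
    have hρ1 : btEps β / 3 < 1 := by linarith [(btEps_pos_le β).2]
    have h := btTau_le hβ hB1 hB2 (hΩm β) (hΩ1 β) (hΩ0 β) (hΩt β) (by linarith [(hr β).2]) (by linarith [(btEps_pos_le β).1])
      hρR hρε hρ1 (hκ₂ β) H1 H2 H3
    rw [hτdef, hCfdef]; dsimp only
    have hZne : fpZ (btEps β) ≠ 0 := (hZ0 β).ne'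
    rw [div_le_iff₀ (hZ0 β)]
    calc _ ≤ powScale 1 β * btC L β (Ω β) (btEps β) (R₁ β) * levelValue su2Rep 1 ((L : ℝ) ^ 3 * β) 0 := h
      _ = powScale 1 β * (btC L β (Ω β) (btEps β) (R₁ β) / fpZ (btEps β)) * levelValue su2Rep 1 ((L : ℝ) ^ 3 * β) 0 * fpZ (btEps β) := by
          field_simp
  have hpt : ∀ᶠ β : ℝ in atTop, ∀ u u' : GaugeConfig 3 1 SU2, orbitDist u < recordDelta1 L s β → orbitDist u' < recordDelta1 L s β →
      |fpBOKernel L β (Ω β) (fpWeight L (btEps β)) u u' - Cf β * transferKernel su2Rep ((L : ℝ) ^ 3 * β) u u'| ≤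
        κ β * Cf β * transferKernel su2Rep ((L : ℝ) ^ 3 * β) u u' + τ β := by
    filter_upwards [hsmall] with β hsm u u' hu hu'
    obtain ⟨hβ, hδ2, hα1, htT, hT, hσ, hεs, hLa, hm₁, hm₂, hP, hP0, hJ⟩ := hsm
    exact fixed_beta_estimate hβ (hΩm β) (hΩ1 β) (hΩ0 β) (hΩinv β) (hΩt β) hδ2 (hα β) hα1 (btEps_pos_le β).1.le htT hT hσ hεs hLa
      hm₁ hm₂ hP hP0 hJ u u' hu hu'
  have hdoor := hT_of_fp_add hs hΩm hΩ1 hΩinv hγ hW hCW hZ0 hZ hC hκ0 hκ₂ hτ0 hτZ hpt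
  filter_upwards [hdoor, hκ', eventually_ge_atTop (0 : ℝ)] with β hβ hrate hβ0 φ hφm hφb hφg hφs
  have h := hβ φ hφm hφb hφg hφs
  obtain ⟨Cφ, hCφ⟩ := hφb
  have hB : (0 : ℝ) ≤ (L : ℝ) ^ 3 * β := by positivity
  have hQ : 0 ≤ qform su2Rep ((L : ℝ) ^ 3 * β) φ φ + levelValue su2Rep 1 ((L : ℝ) ^ 3 * β) 0 * l2 φ φ := by
    have hq := qform_self_nonneg_of_bounded hB hφm hCφ
    have hl2 : 0 ≤ l2 φ φ := by rw [l2_self_eq_integral_sq]; exact integral_nonneg fun u => sq_nonneg _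
    have hl := levelValue_su2Rep_nonneg 1 hB 0
    positivity
  have hσγ : 0 ≤ Cf β / fpZ (btEps β) / recordGamma L Ω β * recordGamma L Ω β := by
    have := hC β; have := hZ0 β; have := hγ β; positivity
  have hrate' : κ β + powScale 1 β ≤ κ' β := hrate
  exact h.trans (mul_le_mul_of_nonneg_right (mul_le_mul_of_nonneg_right hrate' hσγ) hQ)

/-! ## §2 The constant of a profile is positive -/

/-- **`0 < C_Ω = btC L β Ω ε R₁`** for `β ≥ 0`, a profile `0 ≤ Ω ≤ 1` supported in fibre radius `t ≤ 1/30` with `∫Ω dπ > 0`, and `2ε/3 < R₁` (`ε = btEps β`). [cite: Luscher1983, §3] -/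
theorem btC_profile_pos {β : ℝ} (hβ : 0 ≤ β) {Ω : LinkSpace L → ℝ} (hΩm : Measurable Ω) (hΩ1 : ∀ x, |Ω x| ≤ 1) (hΩ0 : ∀ x, 0 ≤ Ω x) {t R₁ : ℝ} (ht : t ≤ 1 / 30)
    (hΩt : ∀ v : Edge 3 L → Fin 3 → ℝ, Ω (linkEmbed L v) ≠ 0 → (∀ (e : Edge 3 L) (c : Fin 3), |v e c| ≤ t) ∧ ‖linkEmbed L v‖ ≤ t)
    (hI : 0 < ∫ v, Ω (linkEmbed L v) ∂orthoTransverse L) (hρR : 2 * (btEps β / 3) < R₁) : 0 < btC L β Ω (btEps β) R₁ := by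
  obtain ⟨hε0, hε1⟩ := btEps_pos_le β
  have hρε : 2 * (btEps β / 3) < btEps β := by linarith
  have hρ1 : btEps β / 3 < 1 := by linarith
  have hfloor := fpBOKernel_one_one_ge hβ hΩm hΩ1 hΩ0 (measurable_coreWeight (L := L) (btEps β) R₁) (abs_coreWeight_le (btEps β) R₁)
    (fun g => (coreWeight_mem_Icc (btEps β) R₁ g).1) (by linarith : 0 ≤ btEps β / 3) ht (fun g hg => coreWeight_ge_one_of_mem_gaugeCore hρR hρε hρ1 hg) hΩt
  have hρ0 : 0 < btEps β / 3 := by linarith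
  have hG : 0 < (gaugeMeasure L).real (gaugeCore L (btEps β / 3)) :=
    lt_of_lt_of_le (by positivity) (gaugeMeasure_real_gaugeCore_ge (L := L) hρ0 (by linarith))
  have hpos : 0 < fpBOKernel L β Ω (coreWeight L (btEps β) R₁) 1 1 := lt_of_lt_of_le (mul_pos (mul_pos (Real.exp_pos _) hG) (pow_pos hI 2)) hfloor
  unfold btC
  exact div_pos hpos (transferKernel_pos _ _ _ _)

/-- `∫ Ω dπ > 0` for a profile `0 ≤ Ω ≤ 1`, measurable, and nonzero on the open ball `{‖x‖ < ρ}`, `ρ > 0`. [folklore] -/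
theorem integral_profile_pos {Ω : LinkSpace L → ℝ} (hΩm : Measurable Ω) (hΩ1 : ∀ x, |Ω x| ≤ 1) (hΩ0 : ∀ x, 0 ≤ Ω x) {ρ : ℝ} (hρ : 0 < ρ)
    (hpos : ∀ x, ‖x‖ < ρ → Ω x ≠ 0) : 0 < ∫ v, Ω (linkEmbed L v) ∂orthoTransverse L := by
  haveI := isFiniteMeasure_orthoTransverse L
  have hf0 : ∀ v : Edge 3 L → Fin 3 → ℝ, 0 ≤ Ω (linkEmbed L v) := fun v => hΩ0 _
  have hfm : Measurable fun v : Edge 3 L → Fin 3 → ℝ => Ω (linkEmbed L v) := hΩm.comp (measurable_linkEmbed L)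
  have hint : Integrable (fun v : Edge 3 L → Fin 3 → ℝ => Ω (linkEmbed L v)) (orthoTransverse L) := integrable_of_measurable_abs_le _ hfm (C := 1) fun v => hΩ1 _
  rw [integral_pos_iff_support_of_nonneg hf0 hint]
  exact lt_of_lt_of_le (orthoTransverse_ball_pos L hρ) (measure_mono fun v hv => hpos _ hv)

end Summit.QuantumFields.YangMills.Theorems.FemtoTransferGap.TwoLattice.ConstTube

end
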